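import Summits.CriticalPhenomena.PercolationContinuityZ3.Theorems.PercNearOneGluingNoHeavyRsw3SlabCriterion
import Summits.CriticalPhenomena.PercolationContinuityZ3.Theorems.PercNearOneGluingNoHeavyLowerTailCSHTheoremOne
import Summits.CriticalPhenomena.PercolationContinuityZ3.Theorems.PercAnnulusCrossingBoxCrossingLength
import Summits.CriticalPhenomena.PercolationContinuityZ3.Theorems.PercNearOneGluingNoHeavyRsw3SlabSpanningCount
import HarnessLib

/-!
# Aizenman's Theorem 2 for bond percolation on `ℤ³`: at `p_c`, thin slab-boxes contain MORE THAN ONE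
# spanning cluster with probability bounded below uniformly in the scale

builds on p205010 (kernel theorem, internal audit signed; external expert review pending)

RSW3 lane (post-continuity programme, LANE 3 "3D box-crossing / quasi-multiplicativity at `p_c(ℤ³)`"), seat
`prim-rsw3-p2` (gen 3), METHOD "3D RSW-lite from continuity".  Helper file for the crux `stmt-CriticalPhenomena-4575`
(`--supports`).  No definitions, no named facts, no sorries.  Notation (`Cross_n`, `TwoSpan_n`) as in
`…Rsw3SlabBlocks.lean`; `P = P_{p_c(ℤ³)}`; `δ₂ = KestenZhang.critTwoArmsDelta 2 = 1/(2·51·200^{49})`.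

M. Aizenman, *On the number of incipient spanning clusters*, Nucl. Phys. B 485 (1997) 551–582, Theorem 2: "For any
dimension `d > 1` there is a function `g_d(t)`, strictly positive for `0 ≤ t < t₀`, with which for every finite size
`L`: `D_L(t, p_c) ≡ P(there is more than one spanning cluster in S_{L,t} = [0,tL] × [0,L]^{d-1}) ≥ g_d(t)`."  This file
proves the `d = 3` bond-percolation case, in the following form (thin side `n`, transverse side `M`, aspect `t = n/M`):

* `real_compl_slabCross_add_twoSpan_gt_criticalProbI` — **the slab dichotomy at `p_c(ℤ³)`, every scale**: for `n ≥ 1`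
  and `3w + 2 ≤ M ≤ 7w + 6`, `P({0..n}×{0..w}² not spanned in direction 0) + P(TwoSpan_n {0..n}×{0..M}²) > δ₂^{49}`
  — Aizenman's criterion (ii) (`theta_pos_of_slab_criterion`) contradicts `θ(p_c) = 0`
  (`CSH.percolationContinuity_allDimensions`, p205010).  (Aizenman closes `p = p_c` without continuity of `θ`, by
  letting `p ↑ p_c` in the finite-volume probabilities; with p205010 in the tree the direct route is shorter.)
* `real_compl_slabCross_le_pow` — **thin cells are spanned with overwhelming probability** (the quantitative half of
  Aizenman's Thm. 1, `h_d(t) ≥ 1 - A e^{-c/t^{d-1}}`, in the weaker "one row of sub-blocks" form that suffices): if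
  `c ≤ P_p({0..n}×{0..2n}² is crossed the short way)` then `P_p({0..n}×{0..w}² not spanned) ≤ (1 - c)^j` whenever
  `j (2n+1) ≤ w + 1` (`j` disjoint translates of the `1:2:2` block, independence); at `p_c` the input is the lane's
  kernel theorem `Crossing.easyCrossingLowerBound_two` (Kesten's sponge bound, p208904).
* `aizenman_twoSpanningClusters_criticalProbI` — **Theorem 2 for `ℤ³`**: there is `K` such that for all `n ≥ 1` and
  all `M ≥ K n`, `P_{p_c(ℤ³)}({0..n}×{0..M}² contains two open paths spanning it in direction 0 that are NOT joined
  inside it) > δ₂^{49}/2` — uniformly in the scale; `aizenman_twoSpanningClusters_easyShape` is the same for the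
  lane's shapes `easyShape k n = (n, kn, kn)`, `k ≥ k₀`.

Reading (numbers, not adjectives).  This is a genuine UNIFORM-IN-SCALE statement of two-arm / non-uniqueness type at
`p_c(ℤ³)` at BOUNDED aspect ratio (the lane's (S2-two-arm) row, in slab-box geometry): the number `N_Free` of spanning
clusters of a thin slab-box is `≥ 2` with probability `≥ δ₂^{49}/2` at every scale.  The constant is explicit and
astronomically small (the tree's `★`-Peierls count; Aizenman's own count gives `b = 1/20` shared between the two
failures); the threshold aspect `K` is explicit in the constant of `EasyCrossingLowerBound 2`.  In print: Aizenman 1997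
Thm. 2 (all `d ≥ 2`); the formal proof is new; the tree previously held only Thms. 3–5 of that paper
(`Literature.Barriers.CriticalPhenomena.SpanningClustersAboveSix*`) and the annulus-geometry dichotomy
`critical_blocking_or_twoArms` (LANE 1), which cannot be resolved because aspect-7 annulus crossings are not near-certain.

References: M. Aizenman, Nucl. Phys. B 485 (1997) 551–582 (arXiv:cond-mat/9609240), §2 Thms. 1–2 [Aizenman1997];
H. Kesten, *Percolation Theory for Mathematicians* (1982), Thm. 5.1 [Kesten1982]; G. Kozma, N. Nitzan (2024), Thm. 6
[KozmaNitzan2024].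
-/

noncomputable section

namespace Summit.CriticalPhenomena.PercolationContinuityZ3.Theorems.Rsw3

open MeasureTheory Literature.Probability.LatticeModels Literature.Probability.Percolation
open Literature.Probability.Percolation.KestenZhang SimpleGraph Relation
open Summit.CriticalPhenomena.PercolationContinuityZ3.Theorems.Crossing

/-! ## The slab dichotomy at `p_c(ℤ³)` -/

/-- **The slab dichotomy at `p_c(ℤ³)`, at every scale** (contrapositive of Aizenman's criterion (ii) at `p_c`): for
`n ≥ 1` and `3w + 2 ≤ M ≤ 7w + 6`,
`P_{p_c}({0..n}×{0..w}² is not spanned in direction 0) + P_{p_c}({0..n}×{0..M}² contains two spanning open paths not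
joined inside it) > δ₂^{49}`.  From `theta_pos_of_slab_criterion` and `θ(p_c) = 0` (p205010,
`CSH.percolationContinuity_allDimensions`).  builds on p205010 (kernel theorem, internal audit signed; external expert
review pending). [cite: Aizenman1997, §2 (proof of Thm. 2: "(1 - R_{L/3,3t}) + D_{L,t} ≥ b for every p ≤ p_c")] -/
theorem real_compl_slabCross_add_twoSpan_gt_criticalProbI {n w M : ℕ} (hn : 1 ≤ n) (hM1 : 3 * w + 2 ≤ M)
    (hM2 : M ≤ 7 * w + 6) :
    critTwoArmsDelta 2 ^ 49 <
      (bondPercolation (zdGraph 3) (criticalProbI 3)).real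
          {ω : BondConfig (Site 3) | ∃ x ∈ Finset.Icc (0 : Site 3) ![(n : ℤ), w, w], ∃ y ∈ Finset.Icc (0 : Site 3) ![(n : ℤ), w, w],
            x 0 = 0 ∧ y 0 = (n : ℤ) ∧ ω ∈ inConn ↑(Finset.Icc (0 : Site 3) ![(n : ℤ), w, w]) x y}ᶜ +
        (bondPercolation (zdGraph 3) (criticalProbI 3)).real
          {ω : BondConfig (Site 3) | ∃ x ∈ Finset.Icc (0 : Site 3) ![(n : ℤ), M, M], ∃ x' ∈ Finset.Icc (0 : Site 3) ![(n : ℤ), M, M],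
            ∃ y ∈ Finset.Icc (0 : Site 3) ![(n : ℤ), M, M], ∃ y' ∈ Finset.Icc (0 : Site 3) ![(n : ℤ), M, M],
            x 0 = 0 ∧ x' 0 = 0 ∧ y 0 = (n : ℤ) ∧ y' 0 = (n : ℤ) ∧
            ω ∈ inConn ↑(Finset.Icc (0 : Site 3) ![(n : ℤ), M, M]) x y ∧
            ω ∈ inConn ↑(Finset.Icc (0 : Site 3) ![(n : ℤ), M, M]) x' y' ∧
            ω ∉ inConn ↑(Finset.Icc (0 : Site 3) ![(n : ℤ), M, M]) x x'} := by
  by_contra h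
  push Not at h
  have hθ : 0 < theta (zdGraph 3) (0 : Site 3) (criticalProbI 3) := theta_pos_of_slab_criterion _ hn hM1 hM2 h
  have h0 : theta (zdGraph 3) (0 : Site 3) (criticalProbI 3) = 0 := CSH.percolationContinuity_allDimensions 3 (by norm_num)
  exact hθ.ne' h0

/-! ## Thin cells are spanned with overwhelming probability -/

/-- `P_p(boxCross L 0) ≤ P_p(Cross_{L₀}(Icc 0 L))`: the lane's crossing event is (almost surely) contained in the spanning
event of this series. [cite: Kesten1982, §3.3 Def. 1–3 (i-crossings)] -/
theorem real_boxCross_le_real_slabCross (p : unitInterval) (L : Site 3) :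
    (bondPercolation (zdGraph 3) p).real (boxCross L 0) ≤
      (bondPercolation (zdGraph 3) p).real
        {ω : BondConfig (Site 3) | ∃ x ∈ Finset.Icc (0 : Site 3) L, ∃ y ∈ Finset.Icc (0 : Site 3) L,
          x 0 = 0 ∧ y 0 = L 0 ∧ ω ∈ inConn ↑(Finset.Icc (0 : Site 3) L) x y} := by
  refine DCT16.real_mono_of_forall_subset_edgeSet (zdGraph 3) p fun ω hω hmem => ?_
  obtain ⟨x, hx, y, hy, hx0, hyL, hconn⟩ := hmem
  exact ⟨x, hx, y, hy, hx0, hyL, mem_inConn_of_mem_openConnIn hω hx hconn⟩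

/-- **Thin cells are spanned with overwhelming probability** ("one row of sub-blocks"): if the `1:2:2` block
`{0..n}×{0..2n}²` is crossed the short way with probability `≥ c` at density `p`, then for `j (2n+1) ≤ w + 1` the cell
`{0..n}×{0..w}²` fails to be spanned in direction `0` with probability `≤ (1 - c)^j`: it contains the `j` disjoint
translates `{0..n}×{0..2n}² + (0, i(2n+1), 0)`, `i < j`, whose crossing events are independent (disjoint edge sets) and
each imply the spanning of the cell.  This is the mechanism of Aizenman's Thm. 1 bound `h_d(t) ≥ 1 - A e^{-c t^{-(d-1)}}`
(there with `t^{-(d-1)}` sub-blocks; one row suffices here). [cite: Aizenman1997, §2 Thm. 1 (h_d(t) → 1 as t ↘ 0; proof in App. B)] -/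
theorem real_compl_slabCross_le_pow (p : unitInterval) {n w j : ℕ} {c : ℝ}
    (hc : c ≤ (bondPercolation (zdGraph 3) p).real (boxCross ![(n : ℤ), ((2 * n : ℕ) : ℤ), ((2 * n : ℕ) : ℤ)] 0))
    (hw : j * (2 * n + 1) ≤ w + 1) :
    (bondPercolation (zdGraph 3) p).real
        {ω : BondConfig (Site 3) | ∃ x ∈ Finset.Icc (0 : Site 3) ![(n : ℤ), w, w], ∃ y ∈ Finset.Icc (0 : Site 3) ![(n : ℤ), w, w],
          x 0 = 0 ∧ y 0 = (n : ℤ) ∧ ω ∈ inConn ↑(Finset.Icc (0 : Site 3) ![(n : ℤ), w, w]) x y}ᶜ ≤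
      (1 - c) ^ j := by
  classical
  set μ := bondPercolation (zdGraph 3) p with hμ
  set C : Finset (Site 3) := Finset.Icc (0 : Site 3) ![(n : ℤ), w, w] with hC
  set Q₀ : Finset (Site 3) := Finset.Icc (0 : Site 3) ![(n : ℤ), ((2 * n : ℕ) : ℤ), ((2 * n : ℕ) : ℤ)] with hQ₀
  set v : ℕ → Site 3 := fun i => ![0, (i : ℤ) * (2 * n + 1), 0] with hv
  have hv0 : ∀ i, v i 0 = 0 := fun i => by simp [hv]
  -- the sub-blocks lie in the cell
  have hQC : ∀ i, i < j → Q₀.image (· + v i) ⊆ C := by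
    intro i hij x hx
    rw [hQ₀, mem_image_Icc_add_iff] at hx
    rw [hC, Finset.mem_Icc]
    have hi1 : (i : ℤ) + 1 ≤ j := by exact_mod_cast hij
    have hw' : (j : ℤ) * (2 * n + 1) ≤ w + 1 := by exact_mod_cast hw
    have hn0 : (0 : ℤ) ≤ n := by positivity
    have hprod := mul_le_mul_of_nonneg_right hi1 (show (0 : ℤ) ≤ 2 * (n : ℤ) + 1 by positivity)
    have h0 := hx 0; have h1 := hx 1; have h2 := hx 2
    simp [hv] at h0 h1 h2
    refine ⟨fun k => ?_, fun k => ?_⟩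
    · fin_cases k <;> simp
      · exact h0.1
      · nlinarith [h1.1]
      · exact h2.1
    · fin_cases k <;> simp
      · exact h0.2
      · nlinarith [h1.2]
      · nlinarith [h2.2]
  -- complement of the cell spanning event ⊆ ⋂ complements of the sub-block crossing events
  have hsub : {ω : BondConfig (Site 3) | ∃ x ∈ C, ∃ y ∈ C, x 0 = 0 ∧ y 0 = (n : ℤ) ∧ ω ∈ inConn ↑C x y}ᶜ ⊆
      ⋂ i ∈ Finset.range j, {ω : BondConfig (Site 3) | ∃ x ∈ Q₀.image (· + v i), ∃ y ∈ Q₀.image (· + v i),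
        x 0 = 0 ∧ y 0 = (n : ℤ) ∧ ω ∈ inConn ↑(Q₀.image (· + v i)) x y}ᶜ := by
    intro ω hω
    simp only [Set.mem_iInter, Set.mem_compl_iff]
    intro i hi hQ
    apply hω
    obtain ⟨x, hx, y, hy, hx0, hy0, hconn⟩ := hQ
    have hi' : i < j := Finset.mem_range.1 hi
    exact ⟨x, hQC i hi' hx, y, hQC i hi' hy, hx0, hy0,
      inConn_mono (Finset.coe_subset.2 (hQC i hi')) _ _ hconn⟩
  -- independence of the sub-block events
  have hdet : ∀ i ∈ Finset.range j, DeterminedBy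
      {ω : BondConfig (Site 3) | ∃ x ∈ Q₀.image (· + v i), ∃ y ∈ Q₀.image (· + v i),
        x 0 = 0 ∧ y 0 = (n : ℤ) ∧ ω ∈ inConn ↑(Q₀.image (· + v i)) x y}ᶜ
      (↑(edgesIn (zdGraph 3) (Q₀.image (· + v i))) : Set (Sym2 (Site 3))) := fun i _ =>
    (determinedBy_slabCross n (Q₀.image (· + v i))).compl'
  have hdisjQ : ∀ i i' : ℕ, i ≠ i' → Disjoint (Q₀.image (· + v i)) (Q₀.image (· + v i')) := by
    intro i i' hne
    rw [Finset.disjoint_left]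
    intro x hx hx'
    rw [hQ₀, mem_image_Icc_add_iff] at hx hx'
    have h1 := hx 1; have h1' := hx' 1
    simp [hv] at h1 h1'
    have hn0 : (0 : ℤ) ≤ n := by positivity
    rcases lt_or_gt_of_ne hne with hlt | hlt
    · have hi1 : (i : ℤ) + 1 ≤ i' := by exact_mod_cast hlt
      have hprod := mul_le_mul_of_nonneg_right hi1 (show (0 : ℤ) ≤ 2 * (n : ℤ) + 1 by positivity)
      nlinarith [h1.2, h1'.1]
    · have hi1 : (i' : ℤ) + 1 ≤ i := by exact_mod_cast hlt
      have hprod := mul_le_mul_of_nonneg_right hi1 (show (0 : ℤ) ≤ 2 * (n : ℤ) + 1 by positivity)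
      nlinarith [h1'.2, h1.1]
  have hdisj : (↑(Finset.range j) : Set ℕ).PairwiseDisjoint
      (fun i => (↑(edgesIn (zdGraph 3) (Q₀.image (· + v i))) : Set (Sym2 (Site 3)))) :=
    fun i _ i' _ hne => disjoint_edgesIn_of_disjoint (hdisjQ i i' hne)
  have hprod := bondPercolation_real_biInter_eq_prod (zdGraph 3) p (Finset.range j) _ _ hdet
    (fun i hi => (hdet i hi).measurableSet_of_finset) hdisj
  -- each factor is at most `1 - c`
  have hfac : ∀ i ∈ Finset.range j, μ.real
      {ω : BondConfig (Site 3) | ∃ x ∈ Q₀.image (· + v i), ∃ y ∈ Q₀.image (· + v i),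
        x 0 = 0 ∧ y 0 = (n : ℤ) ∧ ω ∈ inConn ↑(Q₀.image (· + v i)) x y}ᶜ ≤ 1 - c := by
    intro i _
    have hmeas : MeasurableSet {ω : BondConfig (Site 3) | ∃ x ∈ Q₀.image (· + v i), ∃ y ∈ Q₀.image (· + v i),
        x 0 = 0 ∧ y 0 = (n : ℤ) ∧ ω ∈ inConn ↑(Q₀.image (· + v i)) x y} :=
      (determinedBy_slabCross n (Q₀.image (· + v i))).measurableSet_of_finset
    rw [measureReal_compl hmeas, probReal_univ]
    have htrans : μ.real {ω : BondConfig (Site 3) | ∃ x ∈ Q₀.image (· + v i), ∃ y ∈ Q₀.image (· + v i),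
        x 0 = 0 ∧ y 0 = (n : ℤ) ∧ ω ∈ inConn ↑(Q₀.image (· + v i)) x y} =
        μ.real {ω : BondConfig (Site 3) | ∃ x ∈ Q₀, ∃ y ∈ Q₀, x 0 = 0 ∧ y 0 = (n : ℤ) ∧ ω ∈ inConn ↑Q₀ x y} := by
      rw [hμ, ← bondPercolation_real_preimage_relabel_iso (zdShiftIso (v i)) p, preimage_relabel_slabCross n Q₀ (hv0 i)]
    have hQ : c ≤ μ.real {ω : BondConfig (Site 3) | ∃ x ∈ Q₀, ∃ y ∈ Q₀, x 0 = 0 ∧ y 0 = (n : ℤ) ∧ ω ∈ inConn ↑Q₀ x y} := by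
      refine hc.trans ?_
      have h := real_boxCross_le_real_slabCross p ![(n : ℤ), ((2 * n : ℕ) : ℤ), ((2 * n : ℕ) : ℤ)]
      simpa [hQ₀] using h
    linarith
  calc μ.real {ω : BondConfig (Site 3) | ∃ x ∈ C, ∃ y ∈ C, x 0 = 0 ∧ y 0 = (n : ℤ) ∧ ω ∈ inConn ↑C x y}ᶜ
      ≤ μ.real (⋂ i ∈ Finset.range j, {ω : BondConfig (Site 3) | ∃ x ∈ Q₀.image (· + v i), ∃ y ∈ Q₀.image (· + v i),
          x 0 = 0 ∧ y 0 = (n : ℤ) ∧ ω ∈ inConn ↑(Q₀.image (· + v i)) x y}ᶜ) :=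
        measureReal_mono hsub (measure_ne_top _ _)
    _ = ∏ i ∈ Finset.range j, μ.real {ω : BondConfig (Site 3) | ∃ x ∈ Q₀.image (· + v i), ∃ y ∈ Q₀.image (· + v i),
          x 0 = 0 ∧ y 0 = (n : ℤ) ∧ ω ∈ inConn ↑(Q₀.image (· + v i)) x y}ᶜ := hprod
    _ ≤ ∏ _i ∈ Finset.range j, (1 - c) := Finset.prod_le_prod (fun i _ => measureReal_nonneg) hfac
    _ = (1 - c) ^ j := by rw [Finset.prod_const, Finset.card_range]

/-! ## Theorem 2 for `ℤ³` -/

/-- **Aizenman's Theorem 2 for bond percolation on `ℤ³`** (Nucl. Phys. B 485 (1997), Thm. 2, case `d = 3`): there is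
`K` such that for every `n ≥ 1` and every `M ≥ K n`, at `p_c(ℤ³)` the slab-box `{0..n}×{0..M}²` contains two open
paths spanning it in the thin direction `0` that are NOT joined by an open path inside the box — i.e. at least two
distinct spanning clusters — with probability `> δ₂^{49}/2`, `δ₂ = KestenZhang.critTwoArmsDelta 2`; uniformly in the
scale.  Proof: dichotomy `real_compl_slabCross_add_twoSpan_gt_criticalProbI` with `w = ⌊(M-2)/3⌋`; the thin cell
`{0..n}×{0..w}²` is spanned except with probability `(1-c)^j ≤ δ₂^{49}/2` (`real_compl_slabCross_le_pow` with the lane's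
`Crossing.easyCrossingLowerBound_two`), `K = 9 (j+1)`.  builds on p205010 (kernel theorem, internal audit signed;
external expert review pending). [cite: Aizenman1997, §2 Thm. 2 (D_L(t,p_c) ≥ g_d(t) > 0 for t < t₀)] -/
theorem aizenman_twoSpanningClusters_criticalProbI :
    ∃ K : ℕ, ∀ n : ℕ, 1 ≤ n → ∀ M : ℕ, K * n ≤ M →
      critTwoArmsDelta 2 ^ 49 / 2 <
        (bondPercolation (zdGraph 3) (criticalProbI 3)).real
          {ω : BondConfig (Site 3) | ∃ x ∈ Finset.Icc (0 : Site 3) ![(n : ℤ), M, M], ∃ x' ∈ Finset.Icc (0 : Site 3) ![(n : ℤ), M, M],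
            ∃ y ∈ Finset.Icc (0 : Site 3) ![(n : ℤ), M, M], ∃ y' ∈ Finset.Icc (0 : Site 3) ![(n : ℤ), M, M],
            x 0 = 0 ∧ x' 0 = 0 ∧ y 0 = (n : ℤ) ∧ y' 0 = (n : ℤ) ∧
            ω ∈ inConn ↑(Finset.Icc (0 : Site 3) ![(n : ℤ), M, M]) x y ∧
            ω ∈ inConn ↑(Finset.Icc (0 : Site 3) ![(n : ℤ), M, M]) x' y' ∧
            ω ∉ inConn ↑(Finset.Icc (0 : Site 3) ![(n : ℤ), M, M]) x x'} := by
  obtain ⟨c, hc, hcross⟩ := easyCrossingLowerBound_two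
  have hδ : 0 < critTwoArmsDelta 2 ^ 49 / 2 := by
    have := critTwoArmsDelta_pos 2; positivity
  obtain ⟨j, hj⟩ := exists_pow_lt_of_lt_one hδ (show 1 - c < 1 by linarith)
  refine ⟨9 * (j + 1), fun n hn M hM => ?_⟩
  -- the cell side `w = ⌊(M - 2)/3⌋`
  set w := (M - 2) / 3 with hw
  have hjn : j * (2 * n + 1) ≤ 3 * (j * n) := by nlinarith
  have hM9 : 9 * (j * n) + 9 * n ≤ M := by nlinarith
  have hM1 : 3 * w + 2 ≤ M := by omega
  have hM2 : M ≤ 7 * w + 6 := by omega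
  have hwj : j * (2 * n + 1) ≤ w + 1 := by
    generalize ha : j * (2 * n + 1) = a at hjn ⊢
    generalize hb : j * n = b at hjn hM9
    omega
  -- the thin-cell crossing input at scale `n`
  have hc' : c ≤ (bondPercolation (zdGraph 3) (criticalProbI 3)).real
      (boxCross ![(n : ℤ), ((2 * n : ℕ) : ℤ), ((2 * n : ℕ) : ℤ)] 0) := by
    have h := hcross n hn
    have e : easyShape 2 n = ![(n : ℤ), ((2 * n : ℕ) : ℤ), ((2 * n : ℕ) : ℤ)] := by
      simp only [easyShape]; push_cast; rfl
    rw [e] at h; exact h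
  have hboost := real_compl_slabCross_le_pow (criticalProbI 3) (w := w) hc' hwj
  have hdich := real_compl_slabCross_add_twoSpan_gt_criticalProbI hn hM1 hM2
  linarith [hj.le]

/-- **Theorem 2 for the lane's shapes** `easyShape k n = (n, kn, kn)`: there is `k₀` such that for all `k ≥ k₀` and all
`n ≥ 1`, at `p_c(ℤ³)` the block `{0..n}×{0..kn}²` (`Finset.Icc 0 (easyShape k n)`) contains two open paths spanning it
in direction `0` and not joined inside it, with probability `> δ₂^{49}/2`.  builds on p205010 (kernel theorem, internal
audit signed; external expert review pending). [cite: Aizenman1997, §2 Thm. 2] -/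
theorem aizenman_twoSpanningClusters_easyShape :
    ∃ k₀ : ℕ, ∀ k : ℕ, k₀ ≤ k → ∀ n : ℕ, 1 ≤ n →
      critTwoArmsDelta 2 ^ 49 / 2 <
        (bondPercolation (zdGraph 3) (criticalProbI 3)).real
          {ω : BondConfig (Site 3) | ∃ x ∈ Finset.Icc (0 : Site 3) (easyShape k n), ∃ x' ∈ Finset.Icc (0 : Site 3) (easyShape k n),
            ∃ y ∈ Finset.Icc (0 : Site 3) (easyShape k n), ∃ y' ∈ Finset.Icc (0 : Site 3) (easyShape k n),
            x 0 = 0 ∧ x' 0 = 0 ∧ y 0 = (n : ℤ) ∧ y' 0 = (n : ℤ) ∧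
            ω ∈ inConn ↑(Finset.Icc (0 : Site 3) (easyShape k n)) x y ∧
            ω ∈ inConn ↑(Finset.Icc (0 : Site 3) (easyShape k n)) x' y' ∧
            ω ∉ inConn ↑(Finset.Icc (0 : Site 3) (easyShape k n)) x x'} := by
  obtain ⟨K, hK⟩ := aizenman_twoSpanningClusters_criticalProbI
  refine ⟨K, fun k hk n hn => ?_⟩
  have e : easyShape k n = ![(n : ℤ), ((k * n : ℕ) : ℤ), ((k * n : ℕ) : ℤ)] := by
    simp only [easyShape]; push_cast; rfl
  rw [e]
  exact hK n hn (k * n) (Nat.mul_le_mul_right n hk)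

/-- **Theorem 2 in the lane's vocabulary** (`Crossing.blockSpanningCount`, Aizenman's `N_Free`, defs p207702): there is
`k₀` such that for all `k ≥ k₀` and `n ≥ 1`, at `p_c(ℤ³)` the block `{0..n}×{0..kn}²` has at least TWO open clusters
(components of the open graph induced on the block) meeting both faces `{x₀ = 0}` and `{x₀ = n}`, with probability
`> δ₂^{49}/2 = (KestenZhang.critTwoArmsDelta 2)^{49}/2`, uniformly in `n`.  (Numerically, non-rigorous, the lane's census
finds `N ≥ 2` almost surely at accessible sizes; this is the first RIGOROUS uniform-in-scale non-uniqueness statement at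
bounded aspect ratio for `ℤ³` in the tree.)  builds on p205010 (kernel theorem, internal audit signed; external expert
review pending). [cite: Aizenman1997, §2 Thm. 2 and §5 (N_Free)] -/
theorem aizenman_two_le_blockSpanningCount_easyShape :
    ∃ k₀ : ℕ, ∀ k : ℕ, k₀ ≤ k → ∀ n : ℕ, 1 ≤ n →
      critTwoArmsDelta 2 ^ 49 / 2 <
        (bondPercolation (zdGraph 3) (criticalProbI 3)).real {ω | 2 ≤ blockSpanningCount (easyShape k n) 0 ω} := by
  obtain ⟨k₀, hk₀⟩ := aizenman_twoSpanningClusters_easyShape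
  refine ⟨k₀, fun k hk n hn => (hk₀ k hk n hn).trans_le ?_⟩
  exact real_twoSpan_le_real_two_le_blockSpanningCount (criticalProbI 3) (by simp [easyShape])

end Summit.CriticalPhenomena.PercolationContinuityZ3.Theorems.Rsw3

end
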